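import Literature.AlgebraicGeometry.HodgeTheory.SemiregularVariationalHodgeISemiregular
import HarnessLib

/-!
# Buchweitz–Flenner 2003, Thm. 5.1 (general finite `I`) with the special fibre given UP TO A MODEL ISOMORPHISM
# `e : X₀ ≅ 𝒳_{s₀}` — the binder shape in which the tree renders Bloch's (7.4) (`BlochSemiregularSpreadOfSubscheme`)

Family `hodge`, layer `Literature/AlgebraicGeometry/HodgeTheory`. NAMED FACT (D-0014), a third rendering of
[BuchweitzFlenner2003, Thm. 5.1] next to `BuchweitzFlenner2003_variationalHodge_semiregular` (`I = {1, 2}`,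
`SemiregularVariationalHodge.lean`) and `BuchweitzFlenner2003_variationalHodge_ISemiregular` (finite `I`,
`SemiregularVariationalHodgeISemiregular.lean`); the latter is PROVED below to be the special case `e := Iso.refl _` of
this one. Requested on the bus of the computation cell `pub-hsemireg` (run/shared/lean/pub/pub-hsemireg/: referee
`ref/REVIEW-LEAN-SPINE-1.md` §3(c), lead 2026-08-22T07:14:22Z, `lean/LEAN-SIDE.md` §2 «MODEL TRANSPORT»,
`lit/LEAN-MAP-Bloch1972-BF2003.md` ADDENDUM 3).

## Why a third rendering (the one binder that differs)

The fixed-fibre rendering takes the `I`-semiregular sheaf `ℰ_0` on the tree's CHOSEN fibre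
`Motives.fiberOver π s₀` (a chosen pullback). A consumer holding `ℰ_0` on another model `X₀` of that fibre — every
"sheaf seed" predicate of the tree (`HasTensorBFSheafSeeds`, `WeilClassesBFSheafSeed.lean`) and of the cell
(`HasBFSheafSeedAt`) is therefore forced to quantify over EVERY model `e : Y ≅ X₀` — would otherwise have to transport
`IsISemiregular` along `e`, i.e. use the iso-invariance of the Buchweitz–Flenner components `σ_q` (`sigmaHigher`),
which `SemiregularityHigherSigma.lean` does not construct ("Not here: … functoriality in `X` …", module docstring
there; inventory of what that would take: cell file `lit/LEAN-MAP-Bloch1972-BF2003.md` ADDENDUM 3). Bloch's theorem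
(7.4) is rendered in the tree WITH the model isomorphism in its binders (`BlochSemiregularSpreadOfSubscheme`:
`(X₀) (Z) (i : Z ⟶ X₀.left) … (e : X₀ ≅ fiberOver f s₀)`), which is why the cell's subscheme doors instantiate on one
model; this file gives Thm. 5.1 the same shape.

## Source, verbatim (Compositio Math. 137 (2003); cell copy `lit/BuchweitzFlenner2003-Compositio137/`, PDF page `N` =
printed page `134 + N`; typed in the cell file `lit/BuchweitzFlenner2003.md` §4)

* p. 174 L40–55: "`ℰ_0` is called *`I`-semiregular* if the part of the semiregularity map
  `σ_I : Ext²_{X_0}(ℰ_0, ℰ_0) → ∏_{p∈I} H^{p+1}(X_0, Ω^{p−1}_{X_0})` is injective."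
* p. 174 L56 – p. 175 L4: "**Theorem 5.1.** Let `π : X → S` be a deformation of a compact complex algebraic manifold
  `X_0` over a smooth germ `S = (S, 0)` and set `X_s := π⁻¹(s)` for `s ∈ S`. Assume that `(α_p)_{p∈I}` is a horizontal
  section in `∏_{p∈I} R^p π_*(Ω^p_{X/S})`. If there is an `I`-semiregular sheaf `ℰ_0` on `X_0` with
  `α_p(0) = ch_p(ℰ_0) ∈ H^p(X_0, Ω^p_{X_0})`, `p ∈ I`, then `α_p(s) ∈ H^p(X_s, Ω^p_{X_s})` is algebraic for all
  `s ∈ S` near `0` and each `p ∈ I`."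
* "deformation of `X_0`": BF work in fibred groupoids — p. 180 (Example 6.2) "Let `E` be the category whose objects are
  the germs of flat holomorphic maps `f : (X, X_0) → (S, 0)`, where `X_0 = f⁻¹(0)`. The morphisms […] are all cartesian
  squares", p. 180 L15–19 "If `a' → a` is a cartesian morphism over `f : S' → S`, one sets, slightly abusively,
  `a ×_S S' := a'`", and p. 196–197 (7.18) "By a deformation of `X_0/Y_0` over a germ `(S, 0)` […] we mean a commutative
  diagram […] such that `q` is flat and proper and `f` induces `f_0` on the special fibre `X_0 = q⁻¹(0)`": the special
  fibre is determined up to the (unique) isomorphism of cartesian squares, and a deformation OF `X_0` carries the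
  identification of `X_0` with `π⁻¹(0)` as part of its datum. Rendering that identification by an arbitrary
  isomorphism `e : X₀ ≅ fiberOver π s₀` of `ℂ`-schemes is this file's only change.

## Rendering

Verbatim the carriers of `BuchweitzFlenner2003_variationalHodge_ISemiregular` (module docstring there: algebraic
smooth projective family `π : 𝒳 ⟶ S` of relative dimension `n` over a smooth `ℂ`-scheme, cohomologically locally
trivial `U ⊆ S(ℂ)` with base point `s₀`, Chern character theory `C : ChernCharacterBetti`, finite set `I` of CHERN
degrees, `ℰ_0` finite locally free — the printed coherent generality is NOT rendered, as there —, `I`-semiregularity as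
`IsISemiregular hE₀ {q | q + 1 ∈ I}` in the tree's form-degree numbering, flat transports `transportFun` of type
`(p, p)`, conclusion on an open `W`, `s₀ ∈ W ⊆ U`, for paths inside `W`), with TWO more binders
`(X₀ : Motives.SchemeOver ℂ) (e : X₀ ≅ Motives.fiberOver π s₀)`: `ℰ_0` lives on `X₀`, is `I`-semiregular THERE, and
its classes enter the family through `(e⁻¹)^* ch_p(ℰ_0) ∈ H^{2p}(𝒳_{s₀}(ℂ); ℂ)` (`complexBetti.map e.inv`).

## What is PROVED here, and what is not

* `BuchweitzFlenner2003_variationalHodge_ISemiregular_of_model` — the fixed-fibre rendering follows (take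
  `X₀ := fiberOver π s₀`, `e := Iso.refl _`; `(𝟙)^* = id` is `complexBetti.map_id`).
* `BuchweitzFlenner2003_variationalHodge_ISemiregular_model.ch_mem_algebraicClasses` — consumer shape, one degree.
* `BuchweitzFlenner2003_variationalHodge_ISemiregular_model.map_hom_map_inv` — bookkeeping for consumers:
  `e^*((e⁻¹)^* x) = x`.
* NOT proved: the converse implication (fixed-fibre ⟹ model rendering). On paper it is the tautological invariance of
  `σ_I` under isomorphisms of `X_0`; in the tree it is exactly the missing functoriality of `sigmaHigher` in `X`. The
  content of Thm. 5.1 (Prop. 5.9, Lemma 5.10, versality, Artin approximation) is not formalised either: this stays a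
  named fact, like its two siblings.

## Consumers

The cell `pub-hsemireg` (a ONE-MODEL form of its sheaf door `Summit.Ventures.HSemireg.HasBFSheafSeedAt` /
`HasHyperbolicBFSheafSeed`: with this rendering the seed `ℰ_0` may be given on the anchor `P.X` itself, exactly as the
subscheme doors take `Z ⟶ P.X`); the Weil ladder's door II′ (`WeilClassesBFSheafSeed.lean`) likewise.

## References

* [BuchweitzFlenner2003] R.-O. Buchweitz, H. Flenner, A semiregularity map for modules and applications to deformations,
  Compositio Math. 137 (2003), 135–210 (arXiv:math/9912245): §5 Thm. 5.1 and the definition of `I`-semiregular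
  (p. 174–175), §6 Example 6.2 (p. 180), 7.18 (p. 196–197).
* [Bloch1972Semiregularity] S. Bloch, Semi-regularity and de Rham cohomology, Invent. Math. 17 (1972), 51–66, Thm. (7.4)
  (the tree's rendering `BlochSemiregularSpreadOfSubscheme` carries the model isomorphism in the same way).
-/

noncomputable section

open CategoryTheory AlgebraicGeometry
open _root_.Topology _root_.Filter
open Literature.AlgebraicTopology.SingularHomology

namespace Literature.AlgebraicGeometry.HodgeTheory


/-- **Buchweitz–Flenner 2003, Thm. 5.1, general finite `I`, the special fibre up to a model isomorphism.** Printed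
(p. 174–175): "Let `π : X → S` be a deformation of a compact complex algebraic manifold `X_0` over a smooth germ
`S = (S, 0)` […]. Assume that `(α_p)_{p ∈ I}` is a horizontal section in `∏_{p∈I} R^pπ_*(Ω^p_{X/S})`. If there is an
`I`-semiregular sheaf `ℰ_0` on `X_0` with `α_p(0) = ch_p(ℰ_0)`, `p ∈ I`, then `α_p(s) ∈ H^p(X_s, Ω^p_{X_s})` is
algebraic for all `s ∈ S` near `0` and each `p ∈ I`", where "`ℰ_0` is called `I`-semiregular if the part
`σ_I : Ext²(ℰ_0, ℰ_0) → ∏_{p ∈ I} H^{p+1}(X_0, Ω^{p−1})` of the semiregularity map is injective", a deformation of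
`X_0` being a flat family together with the identification of `X_0` and `π⁻¹(0)` (Example 6.2, 7.18: morphisms of
deformations are cartesian squares; "`f` induces `f_0` on the special fibre"). Rendering (module docstring): for every
Chern character theory `C`, smooth projective family `π : 𝒳 ⟶ S` of relative dimension `n` over a smooth `ℂ`-scheme,
cohomologically locally trivial `U ⊆ S(ℂ)` with base point `s₀`, MODEL `e : X₀ ≅ 𝒳_{s₀}` of the special fibre,
finite set `I` of Chern degrees and finite locally free `ℰ_0` on `X₀` with `(σ_{p−1})_{p ∈ I}` jointly injective
(`IsISemiregular hE₀ {q | q + 1 ∈ I}`): if for every `p ∈ I` the transports of `(e⁻¹)^* ch_p(ℰ_0)` along all paths in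
`U` are of type `(p, p)`, then on some open `W`, `s₀ ∈ W ⊆ U`, the transports of `(e⁻¹)^* ch_p(ℰ_0)` (`p ∈ I`) along
paths inside `W` are ALGEBRAIC classes of the fibres. The tree's fixed-fibre rendering
`BuchweitzFlenner2003_variationalHodge_ISemiregular` is the case `e = Iso.refl _`
(`BuchweitzFlenner2003_variationalHodge_ISemiregular_of_model`).
[cite: BuchweitzFlenner2003, §5 Thm. 5.1 and §5 (I-semiregular); §6 Example 6.2; 7.18] -/
def BuchweitzFlenner2003_variationalHodge_ISemiregular_model : Prop :=
  ∀ (C : ChernCharacterBetti) ⦃𝒳 S : Motives.SchemeOver ℂ⦄ (π : 𝒳 ⟶ S) (n : ℕ),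
    Motives.IsSmoothProjectiveFamily π n → _root_.AlgebraicGeometry.Smooth S.hom →
    ∀ ⦃U : Set (Motives.ComplexPoints S)⦄ (hU : IsCohomologicallyLocallyTrivialOn π U) (s₀ : U)
      (X₀ : Motives.SchemeOver ℂ) (e : X₀ ≅ Motives.fiberOver π s₀.1)
      (E₀ : X₀.left.Modules) (hE₀ : Motives.IsFiniteLocallyFree E₀) (I : Finset ℕ),
      IsISemiregular hE₀ {q | q + 1 ∈ I} →
      (∀ p ∈ I, ∀ (t : U) (γ : Path.Homotopic.Quotient s₀ t),
          IsOfHodgeType n (Motives.fiberOver π t.1) (2 * p) p p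
            (transportFun π (2 * p) hU γ (complexBetti.map e.inv (2 * p) (C.ch X₀ E₀ p)))) →
      ∃ (W : Set (Motives.ComplexPoints S)) (hWo : IsOpen W) (hW₀ : s₀.1 ∈ W) (hWU : W ⊆ U),
        ∀ p ∈ I, ∀ (t : W) (γ : Path.Homotopic.Quotient (⟨s₀.1, hW₀⟩ : W) t),
          transportFun π (2 * p) (hU.mono hWU hWo) γ (complexBetti.map e.inv (2 * p) (C.ch X₀ E₀ p)) ∈
            algebraicClasses (Motives.fiberOver π t.1) p

/-- **The fixed-fibre rendering is the case `e = Iso.refl _` of the model rendering**: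
`BuchweitzFlenner2003_variationalHodge_ISemiregular_model ⟹ BuchweitzFlenner2003_variationalHodge_ISemiregular`
(take `X₀ := fiberOver π s₀`; `(𝟙)^* ch_p(ℰ_0) = ch_p(ℰ_0)` by `complexBetti.map_id`).
[cite: BuchweitzFlenner2003, §5 Thm. 5.1] -/
theorem BuchweitzFlenner2003_variationalHodge_ISemiregular_of_model
    (h : BuchweitzFlenner2003_variationalHodge_ISemiregular_model) :
    BuchweitzFlenner2003_variationalHodge_ISemiregular := by
  intro C 𝒳 S π n hπ hS U hU s₀ E₀ hE₀ I hsr hHodge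
  have key := h C π n hπ hS hU s₀ (Motives.fiberOver π s₀.1) (Iso.refl _) E₀ hE₀ I hsr
  simp only [Iso.refl_inv, complexBetti.map_id] at key
  exact key hHodge

/-- **Consumer shape: one degree.** Under the fact, for each `p ∈ I` the transport of `(e⁻¹)^* ch_p(ℰ_0)` is algebraic
on every fibre over the neighbourhood `W` reached by a path in `W`. [cite: BuchweitzFlenner2003, §5 Thm. 5.1] -/
theorem BuchweitzFlenner2003_variationalHodge_ISemiregular_model.ch_mem_algebraicClasses
    (hBF : BuchweitzFlenner2003_variationalHodge_ISemiregular_model) (C : ChernCharacterBetti)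
    {𝒳 S : Motives.SchemeOver ℂ} (π : 𝒳 ⟶ S) (n : ℕ) (hπ : Motives.IsSmoothProjectiveFamily π n)
    (hS : _root_.AlgebraicGeometry.Smooth S.hom) {U : Set (Motives.ComplexPoints S)}
    (hU : IsCohomologicallyLocallyTrivialOn π U) (s₀ : U) (X₀ : Motives.SchemeOver ℂ)
    (e : X₀ ≅ Motives.fiberOver π s₀.1) (E₀ : X₀.left.Modules) (hE₀ : Motives.IsFiniteLocallyFree E₀)
    (I : Finset ℕ) (hsr : IsISemiregular hE₀ {q | q + 1 ∈ I})
    (hHodge : ∀ p ∈ I, ∀ (t : U) (γ : Path.Homotopic.Quotient s₀ t),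
      IsOfHodgeType n (Motives.fiberOver π t.1) (2 * p) p p
        (transportFun π (2 * p) hU γ (complexBetti.map e.inv (2 * p) (C.ch X₀ E₀ p))))
    {p : ℕ} (hp : p ∈ I) :
    ∃ (W : Set (Motives.ComplexPoints S)) (hWo : IsOpen W) (hW₀ : s₀.1 ∈ W) (hWU : W ⊆ U),
      ∀ (t : W) (γ : Path.Homotopic.Quotient (⟨s₀.1, hW₀⟩ : W) t),
        transportFun π (2 * p) (hU.mono hWU hWo) γ (complexBetti.map e.inv (2 * p) (C.ch X₀ E₀ p)) ∈
          algebraicClasses (Motives.fiberOver π t.1) p := by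
  obtain ⟨W, hWo, hW₀, hWU, hW⟩ := hBF C π n hπ hS hU s₀ X₀ e E₀ hE₀ I hsr hHodge
  exact ⟨W, hWo, hW₀, hWU, fun t γ => hW p hp t γ⟩

/-- **Bookkeeping for consumers**: `e^*((e⁻¹)^* x) = x` on `H^k(X₀(ℂ); ℂ)` — a class prescribed on the model `X₀`
(e.g. `ch_n(ℰ_0) = q·hⁿ + w` with `h`, `w` pulled back from the family through `e`) is recovered from its image
`(e⁻¹)^* x` on the chosen fibre (functoriality of pull-back on singular cohomology: `(g ∘ f)^* = f^* ∘ g^*`,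
`id^* = id`). [cite: FultonYoungTableaux1997, Appendix B §B.1 (1)] -/
theorem BuchweitzFlenner2003_variationalHodge_ISemiregular_model.map_hom_map_inv
    {X₀ Y : Motives.SchemeOver ℂ} (e : X₀ ≅ Y) (k : ℕ) (x : complexBetti X₀ k) :
    complexBetti.map e.hom k (complexBetti.map e.inv k x) = x := by
  rw [← ModuleCat.comp_apply, ← complexBetti.map_comp, Iso.hom_inv_id, complexBetti.map_id]
  rfl

/-- The companion identity `(e⁻¹)^*(e^* y) = y` on `H^k(Y(ℂ); ℂ)` (functoriality of pull-back,
`(g ∘ f)^* = f^* ∘ g^*`, `id^* = id`). [cite: FultonYoungTableaux1997, Appendix B §B.1 (1)] -/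
theorem BuchweitzFlenner2003_variationalHodge_ISemiregular_model.map_inv_map_hom
    {X₀ Y : Motives.SchemeOver ℂ} (e : X₀ ≅ Y) (k : ℕ) (y : complexBetti Y k) :
    complexBetti.map e.inv k (complexBetti.map e.hom k y) = y := by
  rw [← ModuleCat.comp_apply, ← complexBetti.map_comp, Iso.inv_hom_id, complexBetti.map_id]
  rfl

end Literature.AlgebraicGeometry.HodgeTheory
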